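import Literature.MathematicalPhysics.QuantumLattice.FermionGammaFunctor
import Literature.MathematicalPhysics.QuantumLattice.FermionQuasiFree
import Literature.Analysis.Toeplitz.KochDeterminant
import HarnessLib

/-!
# `e^{dΓ(A)} = Γ(e^{A})`, `Tr Γ(g) = det(1 + g)`, and the product trace formula for free fermions

Topic `Literature/MathematicalPhysics/QuantumLattice`; companion of `FermionGammaFunctor` (the
second quantisation `Gamma g = ⊕ₖ Λᵏ g` on the Jordan–Wigner Fock space, with
`Γ(g) c†(f) = c†(gf) Γ(g)`, `Γ(gh) = Γ(g)Γ(h)`). All statements PROVED, no definition introduced.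

* **`exp_dGamma_eq_Gamma_exp : e^{dΓ(A)} = Γ(e^{A})`** for EVERY `A : Matrix ι ι ℂ`
  (Dereziński–Gérard Prop. 3.23 (1) `Γ(e^{h}) = e^{dΓ(h)}`; Bratteli–Robinson II §5.2.1), proved
  algebraically, without differentiation: by the tree's Bogoliubov covariance
  `e^{-dΓ(A)} c†_j e^{dΓ(A)} = Σ_k (e^{-A})_{kj} c†_k` (`exp_dGamma_mul_creation_mul_exp_neg`) and the
  intertwining relation, `e^{-dΓ(A)} Γ(e^{A})` commutes with every `c†_j` and fixes `|∅⟩`, hence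
  is `1` (`eq_one_of_commute_creation_of_mulVec_vacuum`);
* **`trace_Gamma : Tr Γ(g) = det(1 + g)`** for every `g` (sum of the principal minors,
  `det_add_one_eq_sum_minors`; Dereziński–Gérard §17.2.4 "Density matrix": `Tr Γ(γ) = det(𝟙 + γ)`);
* **the product trace formula** `trace_prod_map_exp_dGamma` / `trace_prod_ofFn_exp_dGamma` /
  `trace_prod_ofFn_gibbsWeight_dGamma`:
  `Tr (e^{dΓ(A₁)} ⋯ e^{dΓ(A_M)}) = det(1 + e^{A₁} ⋯ e^{A_M})` for arbitrary, in general
  NON-commuting one-body matrices (imaginary-time transfer matrices / Trotter products of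
  quasi-free fermions, the determinant formula behind determinant QMC), and
  `partitionFn_dGamma_eq_det_of_any` — `Tr e^{-β dΓ(h)} = det(1 + e^{-βh})` for any `h` (the tree's
  `partitionFn_dGamma_eq_det` assumed `h` Hermitian).

## Mathlib / tree search

Tree (REUSED): `Gamma`, `Gamma_mul`, `Gamma_one`, `Gamma_mul_creation`, `Gamma_mulVec_vacuum`,
`eq_one_of_commute_creation_of_mulVec_vacuum` (`FermionGammaFunctor`); `dGamma`, `dGamma_smul`,
`exp_dGamma_mul_creation_mul_exp_neg` (`FermionQuasiFree`); `annihilation_mulVec_vacuum_holds`;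
`Literature.Analysis.Toeplitz.det_add_one_eq_sum_minors` (`det (M + 1) = Σ_S det M_S`);
`Matrix.gibbsWeight`, `Matrix.partitionFn`. Mathlib: `Matrix.exp_add_of_commute`,
`NormedSpace.exp_series_hasSum_exp'`, `HasSum.unique`, `Matrix.det_submatrix_equiv_self`.

## References

* J. Dereziński, C. Gérard, *Mathematics of Quantization and Quantum Fields*, CUP (2013; 2nd ed.
  2022), §3.2.2 Prop. 3.23 (1) (`Γ(e^{h}) = e^{dΓ(h)}`), §17.2.4 "Density matrix"
  (`Tr Γ(γ) = det(𝟙 + γ)`). [DerezinskiGerard2022]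
* O. Bratteli, D. W. Robinson, *Operator Algebras and Quantum Statistical Mechanics 2*, 2nd ed.
  (Springer 1997), §5.2.1 (`Γ(e^{itH}) = e^{it dΓ(H)}`), Prop. 5.2.22 ff. (ideal Fermi gas).
  [BratteliRobinsonII1997]
-/

noncomputable section

namespace Literature.MathematicalPhysics.QuantumLattice

open Matrix Finset NormedSpace RayleighBound
open scoped Matrix.Norms.Operator

variable {ι : Type*} [LinearOrder ι] [Fintype ι]

/-! ### `e^{dΓ(A)} = Γ(e^{A})` -/

/-- `dΓ(A)` annihilates the vacuum. [folklore] -/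
theorem dGamma_mulVec_vacuum (A : Matrix ι ι ℂ) : dGamma A *ᵥ (vacuum : Fock ι) = 0 := by
  rw [dGamma_eq, sum_mulVec]
  refine Finset.sum_eq_zero fun i _ => ?_
  rw [sum_mulVec]
  refine Finset.sum_eq_zero fun j _ => ?_
  rw [smul_mulVec, ← mulVec_mulVec, annihilation_mulVec_vacuum_holds j, mulVec_zero, smul_zero]

/-- A vector killed by `X` is fixed by `e^{X}` (only the constant term of the exponential series
survives). [folklore] -/
theorem exp_mulVec_eq_self_of_mulVec_eq_zero (X : Matrix (Finset ι) (Finset ι) ℂ) (v : Fock ι)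
    (hv : X *ᵥ v = 0) : exp X *ᵥ v = v := by
  have hsum := NormedSpace.exp_series_hasSum_exp' (𝕂 := ℂ) X
  have hmap := hsum.map (mulVec.addMonoidHomLeft v)
    (Continuous.matrix_mulVec continuous_id continuous_const)
  have hterm : (fun n : ℕ => (mulVec.addMonoidHomLeft v) ((n.factorial⁻¹ : ℂ) • X ^ n)) =
      fun n => if n = 0 then v else 0 := by
    funext n
    change ((n.factorial⁻¹ : ℂ) • X ^ n) *ᵥ v = _
    rcases n with _ | n
    · simp
    · rw [if_neg (Nat.succ_ne_zero n), pow_succ, smul_mulVec, ← mulVec_mulVec, hv, mulVec_zero,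
        smul_zero]
  rw [Function.comp_def, hterm] at hmap
  exact hmap.unique (hasSum_ite_eq 0 v)

/-- Bogoliubov covariance in product form: `e^{-dΓ(A)} c†(f) = c†(e^{-A} f) e^{-dΓ(A)}`
(the tree's `exp_dGamma_mul_creation_mul_exp_neg`, smeared and multiplied through).
Bratteli–Robinson II §5.2.1. [folklore] -/
theorem exp_neg_dGamma_mul_create (A : Matrix ι ι ℂ) (f : ι → ℂ) :
    exp (-dGamma A) * create f = create (exp (-A) *ᵥ f) * exp (-dGamma A) := by
  have key : ∀ j, exp (-dGamma A) * creation j = create (fun k => exp (-A) k j) * exp (-dGamma A) := by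
    intro j
    have h := exp_dGamma_mul_creation_mul_exp_neg A (-1) j
    rw [neg_one_smul ℂ (dGamma A), neg_one_smul ℂ A, neg_neg] at h
    have h2 : exp (-dGamma A) * creation j * exp (dGamma A) * exp (-dGamma A) =
        (∑ k, (exp (-A)) k j • creation k) * exp (-dGamma A) := by rw [h]
    rw [mul_assoc, ← Matrix.exp_add_of_commute (dGamma A) (-dGamma A)
      (Commute.neg_right (Commute.refl _)), add_neg_cancel, NormedSpace.exp_zero, mul_one] at h2
    rw [h2]
    rfl
  have hcf : create (exp (-A) *ᵥ f) = ∑ j, f j • create (fun k => exp (-A) k j) := by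
    simp only [create, mulVec, dotProduct, Finset.smul_sum, smul_smul, Finset.sum_smul]
    rw [Finset.sum_comm]
    refine Finset.sum_congr rfl fun i _ => Finset.sum_congr rfl fun j _ => ?_
    rw [mul_comm]
  rw [hcf, create, Finset.mul_sum, Finset.sum_mul]
  refine Finset.sum_congr rfl fun j _ => ?_
  rw [Matrix.mul_smul, Matrix.smul_mul, key]

/-- **`e^{dΓ(A)} = Γ(e^{A})` for every one-body matrix `A`**: the exponential of a quadratic
(particle-number conserving) Hamiltonian is the second quantisation of the one-body exponential.
Proof: `e^{-dΓ(A)} Γ(e^{A})` commutes with all `c†_j` (Bogoliubov covariance + intertwining,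
`e^{-A}e^{A} = 1`) and fixes `|∅⟩`, hence is `1` by cyclicity of the vacuum.
Dereziński–Gérard Prop. 3.23 (1); Bratteli–Robinson II §5.2.1 (`Γ(e^{itH}) = e^{it dΓ(H)}`).
[cite: DerezinskiGerard2022, Prop. 3.23] -/
theorem exp_dGamma_eq_Gamma_exp (A : Matrix ι ι ℂ) : exp (dGamma A) = Gamma (exp A) := by
  set Φ := exp (-dGamma A) * Gamma (exp A) with hΦ
  have hinv : exp (-A) * exp A = 1 := by
    rw [← Matrix.exp_add_of_commute (-A) A (Commute.neg_left (Commute.refl A)), neg_add_cancel,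
      NormedSpace.exp_zero]
  have hinv' : exp (dGamma A) * exp (-dGamma A) = 1 := by
    rw [← Matrix.exp_add_of_commute (dGamma A) (-dGamma A) (Commute.neg_right (Commute.refl _)),
      add_neg_cancel, NormedSpace.exp_zero]
  have hc : ∀ j, Φ * creation j = creation j * Φ := by
    intro j
    have hcol : exp (-A) *ᵥ (fun i => exp A i j) = fun k => (1 : Matrix ι ι ℂ) k j := by
      rw [← hinv]
      funext k
      simp only [mulVec, dotProduct, Matrix.mul_apply]
    have hcr : create (fun k => (1 : Matrix ι ι ℂ) k j) = creation j := by
      simp [create, Matrix.one_apply]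
    rw [hΦ, mul_assoc, Gamma_mul_creation, ← mul_assoc, exp_neg_dGamma_mul_create, hcol, hcr,
      mul_assoc]
  have hvac : Φ *ᵥ vacuum = vacuum := by
    rw [hΦ, ← mulVec_mulVec, Gamma_mulVec_vacuum,
      exp_mulVec_eq_self_of_mulVec_eq_zero _ _ (by rw [neg_mulVec, dGamma_mulVec_vacuum, neg_zero])]
  have hone := eq_one_of_commute_creation_of_mulVec_vacuum Φ hc hvac
  calc exp (dGamma A) = exp (dGamma A) * Φ := by rw [hone, mul_one]
    _ = Gamma (exp A) := by rw [hΦ, ← mul_assoc, hinv', one_mul]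

/-! ### `Tr Γ(g) = det (1 + g)` and the product trace formula -/

omit [Fintype ι] in
/-- The diagonal entries of `Γ(g)` are the principal minors (subtype-indexed form). [folklore] -/
theorem Gamma_apply_self (g : Matrix ι ι ℂ) (S : Finset ι) :
    Gamma g S S = (g.submatrix (Subtype.val : S → ι) Subtype.val).det := by
  rw [Gamma_apply_of_card_eq g (k := S.card) rfl rfl]
  have : g.submatrix (S.orderEmbOfFin rfl) (S.orderEmbOfFin rfl) =
      (g.submatrix (Subtype.val : S → ι) Subtype.val).submatrix (S.orderIsoOfFin rfl).toEquiv
        (S.orderIsoOfFin rfl).toEquiv := by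
    ext i j
    rfl
  rw [this, Matrix.det_submatrix_equiv_self]

/-- **`Tr Γ(g) = det(1 + g)`** for every one-body matrix `g` (sum of all principal minors;
for `g = e^{-βh}` the ideal Fermi gas partition function). Dereziński–Gérard §17.2.4, "Density
matrix": `Tr Γ(γ) = det(𝟙 + γ)`. [cite: DerezinskiGerard2022, §17.2.4] -/
theorem trace_Gamma (g : Matrix ι ι ℂ) : (Gamma g).trace = (1 + g).det := by
  rw [Matrix.trace, add_comm, Literature.Analysis.Toeplitz.det_add_one_eq_sum_minors]
  refine Finset.sum_congr rfl fun S _ => ?_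
  rw [diag_apply, Gamma_apply_self]

/-- `Γ` of a product of matrices (list form). [folklore] -/
theorem Gamma_list_prod (l : List (Matrix ι ι ℂ)) : Gamma l.prod = (l.map Gamma).prod := by
  induction l with
  | nil => rw [List.prod_nil, List.map_nil, List.prod_nil, Gamma_one]
  | cons g l ih => rw [List.prod_cons, Gamma_mul, ih, List.map_cons, List.prod_cons]

/-- A product of exponentials of (non-commuting) quadratic Hamiltonians is the second quantisation
of the product of the one-body exponentials: `∏_τ e^{dΓ(A_τ)} = Γ(∏_τ e^{A_τ})`. [folklore] -/
theorem prod_map_exp_dGamma (l : List (Matrix ι ι ℂ)) :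
    (l.map fun A => exp (dGamma A)).prod = Gamma (l.map exp).prod := by
  induction l with
  | nil => rw [List.map_nil, List.map_nil, List.prod_nil, List.prod_nil, Gamma_one]
  | cons A l ih =>
    rw [List.map_cons, List.map_cons, List.prod_cons, List.prod_cons, ih, exp_dGamma_eq_Gamma_exp,
      Gamma_mul]

/-- **Product trace formula** `Tr (e^{dΓ(A₁)} ⋯ e^{dΓ(A_M)}) = det(1 + e^{A₁} ⋯ e^{A_M})` for
arbitrary, in general NON-commuting one-body matrices `A_τ` (transfer-matrix / Trotter form of the
free-fermion trace; the `M = 1`, Hermitian case is the tree's `partitionFn_dGamma_eq_det`).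
Dereziński–Gérard §17.2.4 with Prop. 3.23 (1). [cite: DerezinskiGerard2022, §17.2.4] -/
theorem trace_prod_map_exp_dGamma (l : List (Matrix ι ι ℂ)) :
    ((l.map fun A => exp (dGamma A)).prod).trace = (1 + (l.map exp).prod).det := by
  rw [prod_map_exp_dGamma, trace_Gamma]

/-- Product trace formula, `Fin`-indexed: `Tr ∏_{τ<M} e^{dΓ(A τ)} = det(1 + ∏_{τ<M} e^{A τ})`.
[cite: DerezinskiGerard2022, §17.2.4] -/
theorem trace_prod_ofFn_exp_dGamma {M : ℕ} (A : Fin M → Matrix ι ι ℂ) :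
    ((List.ofFn fun τ => exp (dGamma (A τ))).prod).trace =
      (1 + (List.ofFn fun τ => exp (A τ)).prod).det := by
  have h1 : (List.ofFn fun τ => exp (dGamma (A τ))) = (List.ofFn A).map fun B => exp (dGamma B) := by
    rw [List.map_ofFn]; rfl
  have h2 : (List.ofFn fun τ => exp (A τ)) = (List.ofFn A).map exp := by
    rw [List.map_ofFn]; rfl
  rw [h1, h2, trace_prod_map_exp_dGamma]

/-- Product trace formula for Gibbs factors: `Tr ∏_τ e^{-a dΓ(H_τ)} = det(1 + ∏_τ e^{-a H_τ})`
(imaginary-time transfer matrices with step `a`). [cite: DerezinskiGerard2022, §17.2.4] -/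
theorem trace_prod_ofFn_gibbsWeight_dGamma (a : ℝ) {M : ℕ} (H : Fin M → Matrix ι ι ℂ) :
    ((List.ofFn fun τ => Matrix.gibbsWeight a (dGamma (H τ))).prod).trace =
      (1 + (List.ofFn fun τ => Matrix.gibbsWeight a (H τ)).prod).det := by
  have h : (fun τ => Matrix.gibbsWeight a (dGamma (H τ))) = fun τ => exp (dGamma (-(a : ℂ) • H τ)) := by
    funext τ
    rw [Matrix.gibbsWeight, dGamma_smul]
  rw [h, trace_prod_ofFn_exp_dGamma]
  rfl

/-- The one-factor case for an ARBITRARY (not necessarily Hermitian) one-body matrix: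
`Tr e^{-β dΓ(h)} = det(1 + e^{-βh})`. Dereziński–Gérard §17.2.4. [cite: DerezinskiGerard2022, §17.2.4] -/
theorem partitionFn_dGamma_eq_det_of_any (β : ℝ) (h : Matrix ι ι ℂ) :
    Matrix.partitionFn β (dGamma h) = (1 + exp (-(β : ℂ) • h)).det := by
  rw [Matrix.partitionFn, Matrix.gibbsWeight, ← dGamma_smul, exp_dGamma_eq_Gamma_exp, trace_Gamma]

end Literature.MathematicalPhysics.QuantumLattice
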